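import Summits.RiemannHypothesis.RiemannHypothesis.Theorems.Splittings.BombieriTruncSynthesisRows
import HarnessLib

/-!
# Splittings — x-wuc GEN-8: MASS-AWARE synthesis, part 1/2 — ALL-CLASSES screening in amplitude coordinates (T8a)
# and the demodulated waveform with `cosh` helpers (UNCONDITIONAL part)

Cell rh-split, seat rh-split-x-wuc g8 (brief sha16 f79c5f09d8bcb036), card `run/shared/lean/pub/rh-split/cards/SPLIT-x-wuc.md` §14.
CARVE NOTE: this file is §G8.1–§G8.3 of the seat's scratch `HOME/rh-split-x-wuc/SplitXWucG8.lean` (sha16 f26699a67be424cc,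
namespace `…Splittings.XWucG8`), declaration text VERBATIM, re-headed into `…Splittings.BombieriTruncMassAware` by rh-split-typer-3 g0
(lead g4 RULING #98, lane (xiv-e)); §G8.4–§G8.5 (the screening hypothesis `OffLineScreenedAbove`, rows X-7, `Phi`, `MassAwareSampling`)
are `Splittings/BombieriTruncMassAwareRows.lean`, which imports this file and re-opens its namespace; the scratch's `#print axioms`
guards are not carried (the referee's `--axioms` replay replaces them).  It IMPORTS the landed g6/g7 modules
(`…Splittings.BombieriTruncSynthesisRows` and its cone).

* G8.1 `pairing_indVec_indVec` — the ONE pairing rule for class indicators: `⟨𝟙_{[k]}, 𝟙_{[l]}⟩ = m_k · [1 − ρ̄_k ∈ class l]`;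
  symmetric OFF-LINE class vectors `symVec j = 𝟙_{[ρ_j]} + 𝟙_{[1−ρ̄_j]}` pair to `+2m_j` and are pairing-orthogonal to every other
  class vector / indicator.
* G8.2 `offHelperVec`, `allVec = synthVec j₀ S f a + offHelperVec S' g A` (target class antisymmetric, ON-LINE helpers, OFF-LINE
  symmetric helpers of OTHER classes), its pairing `−2m₀ + Σ_i |a_i|²/m_{f i} + Σ_j 2|A_j|²/m_{g j}` and **(T8a) `synth_negRoot_all`**:
  `cost + c·(Σ_i |a_i|²/m_{f i} + Σ_j 2|A_j|²/m_{g j}) < 2c·m₀ ⟹ 𝒦_{[−1,1]}(Γ_N)` has a real eigenvalue in `(−c, 0)` —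
  UNCONDITIONAL, multiplicities KEPT as weights (T7a threw them away), every class of `Γ_N` usable as a helper.
* G8.3 demodulation: `‖F(allVec)(u)‖ = ‖2m₀ sinh(κ₀u) − Σ_i a_i e^{−i(t_i−τ₀)u} − Σ_j 2A_j cosh(κ_j u) e^{−i(t_j−τ₀)u}‖`.
LABEL: RH-FREE linear algebra / bookkeeping over the landed truncation objects (`truncIdx`, `pairing`, `indVec`, `classVec`, `F`);
certifies nothing about RH.  Three data `def`s (`symVec`, `offHelperVec`, `allVec`) ⇒ definition lane.
HONEST LABEL: «SPLITTING SEARCH over kernel-typed RH-EQUIVALENCES; a splitting A ∧ B ⟹ RH is CONDITIONAL bookkeeping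
unless A and B are both proved; nothing here bears on the truth of RH.»
-/

set_option linter.dupNamespace false

noncomputable section

open scoped Classical ComplexConjugate
open Set Filter Topology Complex MeasureTheory

namespace Summit.RiemannHypothesis.RiemannHypothesis.Theorems.Splittings.BombieriTruncMassAware

open Literature.NumberTheory.LFunctions Literature.NumberTheory.LFunctions.Bombieri2000
open Summit.RiemannHypothesis.RiemannHypothesis.Theses.RuelleBand
open Summit.RiemannHypothesis.RiemannHypothesis.Theorems.Splittings.BombieriTruncEigen
open Summit.RiemannHypothesis.RiemannHypothesis.Theorems.Splittings.BombieriFozNoDep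
open Summit.RiemannHypothesis.RiemannHypothesis.Theorems.Splittings.BombieriTruncGram
open Summit.RiemannHypothesis.RiemannHypothesis.Theorems.Splittings.BombieriTruncPairing
open Summit.RiemannHypothesis.RiemannHypothesis.Theorems.Splittings.BombieriTruncScreening
open Summit.RiemannHypothesis.RiemannHypothesis.Theorems.Splittings.BombieriTruncBandGap
open Summit.RiemannHypothesis.RiemannHypothesis.Theorems.Splittings.BombieriTruncMultiplicity
open Summit.RiemannHypothesis.RiemannHypothesis.Theorems.Splittings.BombieriTruncEventualStrip
open Summit.RiemannHypothesis.RiemannHypothesis.Theorems.Splittings.BombieriTruncExactness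
open Summit.RiemannHypothesis.RiemannHypothesis.Theorems.Splittings.BombieriTruncClump
open Summit.RiemannHypothesis.RiemannHypothesis.Theorems.Splittings.BombieriTruncOffLineSparse
open Summit.RiemannHypothesis.RiemannHypothesis.Theorems.Splittings.BombieriTruncSynthesis
open Summit.RiemannHypothesis.RiemannHypothesis.Theorems.Splittings.BombieriTruncSynthesisScreening
open Summit.RiemannHypothesis.RiemannHypothesis.Theorems.Splittings.BombieriTruncSynthesisRows

variable {N : ℕ}

/-! ### G8.1 The pairing rule for class indicators; symmetric OFF-LINE class vectors -/

/-- For `s` in the class of `k`, the mirror slot `tbar s` lies in the class of `l` iff the mirror of `k` does. -/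
theorem tbar_mem_fib_iff_of_mem {k l s : truncIdx N} (hs : s ∈ fib k) : tbar s ∈ fib l ↔ tbar k ∈ fib l := by
  rw [mem_fib, mem_fib, val_tbar_eq_of_val_eq (mem_fib.1 hs)]

/-- **The ONE pairing rule for class indicators:** `pairing 𝟙_{[k]} 𝟙_{[l]} = m_k` if the MIRROR class of `k` is the class of `l`,
and `0` otherwise. [new] -/
theorem pairing_indVec_indVec (k l : truncIdx N) :
    pairing N (indVec k) (indVec l) = if tbar k ∈ fib l then ((fib k).card : ℂ) else 0 := by
  unfold pairing
  have h : ∀ s : truncIdx N, conj (indVec k s) * indVec l (tbar s) =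
      if s ∈ fib k then (if tbar k ∈ fib l then (1 : ℂ) else 0) else 0 := by
    intro s
    by_cases hs : s ∈ fib k
    · simp [indVec, hs, tbar_mem_fib_iff_of_mem hs]
    · simp [indVec, hs]
  rw [Finset.sum_congr rfl fun s _ ↦ h s, Finset.sum_ite_mem, Finset.univ_inter, Finset.sum_const, nsmul_eq_mul]
  split_ifs <;> simp

/-- `tbar k ∈ fib l ↔ 1 − ρ̄_k = ρ_l` (as values). -/
theorem tbar_mem_fib_iff_val {k l : truncIdx N} :
    tbar k ∈ fib l ↔ ((tbar k : truncIdx N) : ZeroIdx).val = (l : ZeroIdx).val := mem_fib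

/-- Indicator pairing vanishes when `1 − ρ̄_k ≠ ρ_l`. -/
theorem pairing_indVec_indVec_of_ne {k l : truncIdx N}
    (h : ((tbar k : truncIdx N) : ZeroIdx).val ≠ (l : ZeroIdx).val) : pairing N (indVec k) (indVec l) = 0 := by
  rw [pairing_indVec_indVec, if_neg (fun h' ↦ h (tbar_mem_fib_iff_val.1 h'))]

/-- Indicator pairing is `m_k` when `1 − ρ̄_k = ρ_l`. -/
theorem pairing_indVec_indVec_of_eq {k l : truncIdx N}
    (h : ((tbar k : truncIdx N) : ZeroIdx).val = (l : ZeroIdx).val) : pairing N (indVec k) (indVec l) = (fib k).card := by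
  rw [pairing_indVec_indVec, if_pos (tbar_mem_fib_iff_val.2 h)]

/-- An off-line slot is not its own mirror class: `1 − ρ̄_j ≠ ρ_j`. -/
private theorem val_tbar_ne_self {j : truncIdx N} (hj : (j : ZeroIdx).OffLine) :
    ((tbar j : truncIdx N) : ZeroIdx).val ≠ (j : ZeroIdx).val := val_tbar_ne_val hj

/-- The SYMMETRIC class vector of the slot `j`: `+1` on the class of `ρ_j` AND `+1` on the class of `1 − ρ̄_j`
(the waveform `2m_j cosh(κ_j u) e^{−iτ_j u}`; for an OFF-LINE `j` it pairs to `+2m_j`). [new] -/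
def symVec (j : truncIdx N) : truncIdx N → ℂ := indVec j + indVec (tbar j)

/-- `symVec j` is class-constant. -/
theorem symVec_mem (j : truncIdx N) : symVec j ∈ classSub N := (classSub N).add_mem (indVec_mem j) (indVec_mem (tbar j))

/-- For an OFF-LINE slot, `pairing (symVec j) (symVec j) = 2 m_j`. -/
theorem pairing_symVec_self {j : truncIdx N} (hj : (j : ZeroIdx).OffLine) :
    pairing N (symVec j) (symVec j) = 2 * (fib j).card := by
  have h1 : pairing N (indVec j) (indVec j) = 0 := pairing_indVec_indVec_of_ne (val_tbar_ne_self hj)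
  have h2 : pairing N (indVec j) (indVec (tbar j)) = (fib j).card := pairing_indVec_indVec_of_eq rfl
  have h3 : pairing N (indVec (tbar j)) (indVec j) = (fib j).card := by
    rw [pairing_indVec_indVec_of_eq (by rw [tbar_tbar]), card_fib_tbar]
  have h4 : pairing N (indVec (tbar j)) (indVec (tbar j)) = 0 :=
    pairing_indVec_indVec_of_ne (by rw [tbar_tbar]; exact (val_tbar_ne_self hj).symm)
  rw [symVec, pairing_add_left, pairing_add_right, pairing_add_right, h1, h2, h3, h4]
  ring

/-- Symmetric class vectors of slots carrying DIFFERENT, NON-MIRROR zeros are pairing-orthogonal. -/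
theorem pairing_symVec_symVec_eq_zero {j l : truncIdx N}
    (h1 : (j : ZeroIdx).val ≠ (l : ZeroIdx).val) (h2 : (j : ZeroIdx).val ≠ ((tbar l : truncIdx N) : ZeroIdx).val) :
    pairing N (symVec j) (symVec l) = 0 := by
  have e1 : pairing N (indVec j) (indVec l) = 0 :=
    pairing_indVec_indVec_of_ne fun h ↦ h2 (by rw [← tbar_tbar j, val_tbar_eq_of_val_eq (i := tbar j) (j := l) h])
  have e2 : pairing N (indVec j) (indVec (tbar l)) = 0 :=
    pairing_indVec_indVec_of_ne fun h ↦ h1 (by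
      have := val_tbar_eq_of_val_eq (i := tbar j) (j := tbar l) h
      rwa [tbar_tbar, tbar_tbar] at this)
  have e3 : pairing N (indVec (tbar j)) (indVec l) = 0 := pairing_indVec_indVec_of_ne (by rw [tbar_tbar]; exact h1)
  have e4 : pairing N (indVec (tbar j)) (indVec (tbar l)) = 0 := pairing_indVec_indVec_of_ne (by rw [tbar_tbar]; exact h2)
  rw [symVec, symVec, pairing_add_left, pairing_add_right, pairing_add_right, e1, e2, e3, e4]
  ring

/-- The target's antisymmetric class vector is `𝟙_{[j₀]} − 𝟙_{[1−ρ̄_{j₀}]}`. -/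
theorem classVec_eq (j₀ : truncIdx N) : classVec j₀ = indVec j₀ - indVec (tbar j₀) := rfl

/-- `pairing` with a difference on the left. -/
theorem pairing_sub_left (x y z : truncIdx N → ℂ) : pairing N (x - y) z = pairing N x z - pairing N y z := by
  simp only [pairing, Pi.sub_apply, map_sub, sub_mul, Finset.sum_sub_distrib]

/-- `pairing` with a difference on the right. -/
theorem pairing_sub_right (x y z : truncIdx N → ℂ) : pairing N x (y - z) = pairing N x y - pairing N x z := by
  simp only [pairing, Pi.sub_apply, mul_sub, Finset.sum_sub_distrib]

/-- The target's class vector is pairing-orthogonal to the symmetric vector of any OTHER, NON-MIRROR class … -/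
theorem pairing_classVec_symVec_eq_zero {j₀ l : truncIdx N}
    (h1 : (l : ZeroIdx).val ≠ (j₀ : ZeroIdx).val) (h2 : (l : ZeroIdx).val ≠ ((tbar j₀ : truncIdx N) : ZeroIdx).val) :
    pairing N (classVec j₀) (symVec l) = 0 := by
  have e1 : pairing N (indVec j₀) (indVec l) = 0 := pairing_indVec_indVec_of_ne (fun h ↦ h2 h.symm)
  have e2 : pairing N (indVec j₀) (indVec (tbar l)) = 0 :=
    pairing_indVec_indVec_of_ne fun h ↦ h1 (by
      have := val_tbar_eq_of_val_eq (i := tbar j₀) (j := tbar l) h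
      rw [tbar_tbar, tbar_tbar] at this
      exact this.symm)
  have e3 : pairing N (indVec (tbar j₀)) (indVec l) = 0 :=
    pairing_indVec_indVec_of_ne (by rw [tbar_tbar]; exact fun h ↦ h1 h.symm)
  have e4 : pairing N (indVec (tbar j₀)) (indVec (tbar l)) = 0 :=
    pairing_indVec_indVec_of_ne (by
      rw [tbar_tbar]
      exact fun h ↦ h2 (by rw [← tbar_tbar l, val_tbar_eq_of_val_eq (i := j₀) (j := tbar l) h]))
  rw [classVec_eq, symVec, pairing_sub_left, pairing_add_right, pairing_add_right, e1, e2, e3, e4]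
  ring

/-- … in both orders. -/
theorem pairing_symVec_classVec_eq_zero {j₀ l : truncIdx N}
    (h1 : (l : ZeroIdx).val ≠ (j₀ : ZeroIdx).val) (h2 : (l : ZeroIdx).val ≠ ((tbar j₀ : truncIdx N) : ZeroIdx).val) :
    pairing N (symVec l) (classVec j₀) = 0 := by
  have e1 : pairing N (indVec l) (indVec j₀) = 0 :=
    pairing_indVec_indVec_of_ne fun h ↦ h2 (by rw [← tbar_tbar l, val_tbar_eq_of_val_eq (i := tbar l) (j := j₀) h])
  have e2 : pairing N (indVec l) (indVec (tbar j₀)) = 0 :=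
    pairing_indVec_indVec_of_ne fun h ↦ h1 (by
      have := val_tbar_eq_of_val_eq (i := tbar l) (j := tbar j₀) h
      rwa [tbar_tbar, tbar_tbar] at this)
  have e3 : pairing N (indVec (tbar l)) (indVec j₀) = 0 := pairing_indVec_indVec_of_ne (by rw [tbar_tbar]; exact h1)
  have e4 : pairing N (indVec (tbar l)) (indVec (tbar j₀)) = 0 := pairing_indVec_indVec_of_ne (by rw [tbar_tbar]; exact h2)
  rw [classVec_eq, symVec, pairing_add_left, pairing_sub_right, pairing_sub_right, e1, e2, e3, e4]
  ring

/-- An ON-LINE indicator and the symmetric vector of an OFF-LINE class are pairing-orthogonal (real parts differ) … -/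
theorem pairing_indVec_symVec_eq_zero {k l : truncIdx N} (hk : ¬ (k : ZeroIdx).OffLine) (hl : (l : ZeroIdx).OffLine) :
    pairing N (indVec k) (symVec l) = 0 := by
  have hk' : tbar k = k := tbar_eq_self hk
  have hre : (k : ZeroIdx).val.re = 1 / 2 := re_of_not_offLine hk
  have e1 : pairing N (indVec k) (indVec l) = 0 :=
    pairing_indVec_indVec_of_ne (by rw [hk']; exact fun h ↦ hl (by rw [← h]; exact hre))
  have e2 : pairing N (indVec k) (indVec (tbar l)) = 0 :=
    pairing_indVec_indVec_of_ne (by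
      rw [hk']
      intro h
      have h' := re_val_tbar l
      rw [← h, hre] at h'
      exact hl (by linarith))
  rw [symVec, pairing_add_right, e1, e2, add_zero]

/-- … in both orders. -/
theorem pairing_symVec_indVec_eq_zero {k l : truncIdx N} (hk : ¬ (k : ZeroIdx).OffLine) (hl : (l : ZeroIdx).OffLine) :
    pairing N (symVec l) (indVec k) = 0 := by
  have hre : (k : ZeroIdx).val.re = 1 / 2 := re_of_not_offLine hk
  have e1 : pairing N (indVec l) (indVec k) = 0 :=
    pairing_indVec_indVec_of_ne (by
      intro h
      have h' := re_val_tbar l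
      rw [h, hre] at h'
      exact hl (by linarith))
  have e2 : pairing N (indVec (tbar l)) (indVec k) = 0 :=
    pairing_indVec_indVec_of_ne (by rw [tbar_tbar]; exact fun h ↦ hl (by rw [h]; exact hre))
  rw [symVec, pairing_add_left, e1, e2, add_zero]


/-! ### G8.2 OFF-LINE symmetric helpers, the ALL-CLASSES synthesis vector and (T8a) -/

/-- The OFF-LINE helpers: amplitudes `A_j` on the SYMMETRIC class vectors of the slots `g j`, normalised by the multiplicity
(waveform `Σ_j 2A_j cosh(κ_j u) e^{−iτ_j u}`, debit `Σ_j 2|A_j|²/m_{g j}`). -/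
def offHelperVec {ι' : Type*} (S' : Finset ι') (g : ι' → truncIdx N) (A : ι' → ℂ) : truncIdx N → ℂ :=
  ∑ j ∈ S', (A j / ((fib (g j)).card : ℂ)) • symVec (g j)

/-- The off-line helper vector lies in `classSub N`. -/
theorem offHelperVec_mem {ι' : Type*} (S' : Finset ι') (g : ι' → truncIdx N) (A : ι' → ℂ) :
    offHelperVec S' g A ∈ classSub N :=
  Submodule.sum_mem _ fun j _ ↦ Submodule.smul_mem _ _ (symVec_mem (g j))

/-- The ALL-CLASSES synthesis vector of the off-line target `j₀`: its antisymmetric class vector, ON-LINE helpers `(S, f, a)` and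
OFF-LINE symmetric helpers `(S', g, A)`. -/
def allVec (j₀ : truncIdx N) {ι ι' : Type*} (S : Finset ι) (f : ι → truncIdx N) (a : ι → ℂ)
    (S' : Finset ι') (g : ι' → truncIdx N) (A : ι' → ℂ) : truncIdx N → ℂ :=
  synthVec j₀ S f a + offHelperVec S' g A

/-- The all-classes synthesis vector lies in `classSub N`. -/
theorem allVec_mem (j₀ : truncIdx N) {ι ι' : Type*} (S : Finset ι) (f : ι → truncIdx N) (a : ι → ℂ)
    (S' : Finset ι') (g : ι' → truncIdx N) (A : ι' → ℂ) : allVec j₀ S f a S' g A ∈ classSub N :=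
  (classSub N).add_mem (synthVec_mem j₀ S f a) (offHelperVec_mem S' g A)

/-- The off-line helpers pair to `Σ_j 2|A_j|²/m_{g j}` when the slots `g j` carry OFF-LINE zeros of pairwise DIFFERENT, NON-MIRROR
classes. -/
theorem pairing_offHelperVec {ι' : Type*} (S' : Finset ι') {g : ι' → truncIdx N}
    (hoff : ∀ j ∈ S', ((g j : truncIdx N) : ZeroIdx).OffLine)
    (hsep : ∀ j ∈ S', ∀ l ∈ S', j ≠ l →
      ((g j : truncIdx N) : ZeroIdx).val ≠ ((g l : truncIdx N) : ZeroIdx).val ∧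
        ((g j : truncIdx N) : ZeroIdx).val ≠ ((tbar (g l) : truncIdx N) : ZeroIdx).val)
    (A : ι' → ℂ) :
    pairing N (offHelperVec S' g A) (offHelperVec S' g A) =
      ((∑ j ∈ S', 2 * ‖A j‖ ^ 2 / ((fib (g j)).card : ℝ) : ℝ) : ℂ) := by
  rw [offHelperVec, pairing_finset_sum, Complex.ofReal_sum]
  refine Finset.sum_congr rfl fun j hj ↦ ?_
  rw [Finset.sum_eq_single j (fun l hl hlj ↦ ?_) (fun h ↦ absurd hj h)]
  · rw [pairing_symVec_self (hoff j hj)]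
    have h : ((fib (g j)).card : ℂ) ≠ 0 := Nat.cast_ne_zero.2 (fib_card_pos (g j)).ne'
    push_cast
    rw [map_div₀, Complex.conj_natCast, div_mul_div_comm, Complex.conj_mul', ← Complex.ofReal_pow]
    field_simp
  · obtain ⟨h1, h2⟩ := hsep j hj l hl (Ne.symm hlj)
    rw [pairing_symVec_symVec_eq_zero h1 h2, mul_zero]

/-- **Pairing of the all-classes synthesis vector** (real part): `−2m₀ + Σ_i |a_i|²/m_{f i} + Σ_j 2|A_j|²/m_{g j}` — all six cross
pairings vanish (on-line vs off-line classes; the target class vs OTHER non-mirror classes). [new] -/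
theorem re_pairing_allVec {j₀ : truncIdx N} (hj : (j₀ : ZeroIdx).OffLine) {ι ι' : Type*} (S : Finset ι)
    {f : ι → truncIdx N} (hon : ∀ i ∈ S, ¬ ((f i : truncIdx N) : ZeroIdx).OffLine)
    (hinj : ∀ i ∈ S, ∀ l ∈ S, ((f i : truncIdx N) : ZeroIdx).val = ((f l : truncIdx N) : ZeroIdx).val → i = l)
    (a : ι → ℂ) (S' : Finset ι') {g : ι' → truncIdx N}
    (hoff : ∀ j ∈ S', ((g j : truncIdx N) : ZeroIdx).OffLine)
    (hother : ∀ j ∈ S', ((g j : truncIdx N) : ZeroIdx).val ≠ (j₀ : ZeroIdx).val ∧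
      ((g j : truncIdx N) : ZeroIdx).val ≠ ((tbar j₀ : truncIdx N) : ZeroIdx).val)
    (hsep : ∀ j ∈ S', ∀ l ∈ S', j ≠ l →
      ((g j : truncIdx N) : ZeroIdx).val ≠ ((g l : truncIdx N) : ZeroIdx).val ∧
        ((g j : truncIdx N) : ZeroIdx).val ≠ ((tbar (g l) : truncIdx N) : ZeroIdx).val)
    (A : ι' → ℂ) :
    (pairing N (allVec j₀ S f a S' g A) (allVec j₀ S f a S' g A)).re =
      -2 * (fib j₀).card + ∑ i ∈ S, ‖a i‖ ^ 2 / ((fib (f i)).card : ℝ) +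
        ∑ j ∈ S', 2 * ‖A j‖ ^ 2 / ((fib (g j)).card : ℝ) := by
  -- the four new cross terms
  have c1 : pairing N (classVec j₀) (offHelperVec S' g A) = 0 := by
    rw [offHelperVec, pairing_sum_smul_right]
    exact Finset.sum_eq_zero fun j hj' ↦ by
      rw [pairing_classVec_symVec_eq_zero (hother j hj').1 (hother j hj').2, mul_zero]
  have c2 : pairing N (offHelperVec S' g A) (classVec j₀) = 0 := by
    rw [offHelperVec, pairing_sum_smul_left]
    exact Finset.sum_eq_zero fun j hj' ↦ by
      rw [pairing_symVec_classVec_eq_zero (hother j hj').1 (hother j hj').2, mul_zero]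
  have c3 : pairing N (helperVec S f a) (offHelperVec S' g A) = 0 := by
    rw [offHelperVec, pairing_sum_smul_right]
    refine Finset.sum_eq_zero fun j hj' ↦ ?_
    rw [helperVec, pairing_sum_smul_left]
    rw [Finset.sum_eq_zero fun i hi ↦ by rw [pairing_indVec_symVec_eq_zero (hon i hi) (hoff j hj'), mul_zero], mul_zero]
  have c4 : pairing N (offHelperVec S' g A) (helperVec S f a) = 0 := by
    rw [helperVec, pairing_sum_smul_right]
    refine Finset.sum_eq_zero fun i hi ↦ ?_
    rw [offHelperVec, pairing_sum_smul_left]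
    rw [Finset.sum_eq_zero fun j hj' ↦ by rw [pairing_symVec_indVec_eq_zero (hon i hi) (hoff j hj'), mul_zero], mul_zero]
  have c13 : pairing N (synthVec j₀ S f a) (offHelperVec S' g A) = 0 := by
    rw [synthVec, pairing_add_left, c1, c3, add_zero]
  have c24 : pairing N (offHelperVec S' g A) (synthVec j₀ S f a) = 0 := by
    rw [synthVec, pairing_add_right, c2, c4, add_zero]
  rw [allVec, pairing_add_left, pairing_add_right, pairing_add_right, c13, c24, add_zero, zero_add, Complex.add_re,
    re_pairing_synthVec hj S hon hinj a, pairing_offHelperVec S' hoff hsep A, Complex.ofReal_re]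

/-- **(T8a) ALL-CLASSES SCREENING THEOREM in amplitude coordinates** (kernel; UNCONDITIONAL).  Let `j₀ ∈ Γ_N` carry an OFF-LINE zero of
class multiplicity `m₀`; let `f i` (`i ∈ S`) be slots carrying pairwise different ON-LINE zeros with amplitudes `a_i`, and `g j` (`j ∈ S'`)
slots carrying OFF-LINE zeros of pairwise different, non-mirror classes other than the two classes of the target, with amplitudes `A_j`.  If
`∫_{[−1,1]} |F(allVec)(u)|² du + c·(Σ_i |a_i|²/m_{f i} + Σ_j 2|A_j|²/m_{g j}) < 2c·m₀`
then `𝒦_{[−1,1]}(Γ_N)` has a real eigenvalue in `(−c, 0)`.  The helper DEBIT is `|amplitude|²/multiplicity`: the multiplicity of a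
helper class is a WEIGHT (mass), that of the target a BUDGET `2c·m₀` against the waveform `2m₀ sinh(κ₀u)` (G8.3). [new] -/
theorem synth_negRoot_all {j₀ : truncIdx N} (hj : (j₀ : ZeroIdx).OffLine) {ι ι' : Type*} (S : Finset ι)
    {f : ι → truncIdx N} (hon : ∀ i ∈ S, ¬ ((f i : truncIdx N) : ZeroIdx).OffLine)
    (hinj : ∀ i ∈ S, ∀ l ∈ S, ((f i : truncIdx N) : ZeroIdx).val = ((f l : truncIdx N) : ZeroIdx).val → i = l)
    (a : ι → ℂ) (S' : Finset ι') {g : ι' → truncIdx N}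
    (hoff : ∀ j ∈ S', ((g j : truncIdx N) : ZeroIdx).OffLine)
    (hother : ∀ j ∈ S', ((g j : truncIdx N) : ZeroIdx).val ≠ (j₀ : ZeroIdx).val ∧
      ((g j : truncIdx N) : ZeroIdx).val ≠ ((tbar j₀ : truncIdx N) : ZeroIdx).val)
    (hsep : ∀ j ∈ S', ∀ l ∈ S', j ≠ l →
      ((g j : truncIdx N) : ZeroIdx).val ≠ ((g l : truncIdx N) : ZeroIdx).val ∧
        ((g j : truncIdx N) : ZeroIdx).val ≠ ((tbar (g l) : truncIdx N) : ZeroIdx).val)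
    (A : ι' → ℂ) {c : ℝ} (hc : 0 < c)
    (h : (∫ u in Icc (-1 : ℝ) 1, ‖F N (allVec j₀ S f a S' g A) u‖ ^ 2) +
        c * (∑ i ∈ S, ‖a i‖ ^ 2 / ((fib (f i)).card : ℝ) + ∑ j ∈ S', 2 * ‖A j‖ ^ 2 / ((fib (g j)).card : ℝ)) <
      2 * c * (fib j₀).card) :
    ∃ μ ∈ (truncKMat (Icc (-1 : ℝ) 1) N).charpoly.roots, μ.im = 0 ∧ -c < μ.re ∧ μ.re < 0 := by
  refine exists_negRoot_of_screening_mult one_pos hc (allVec_mem j₀ S f a S' g A) ?_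
  rw [re_pairing_allVec hj S hon hinj a S' hoff hother hsep A]
  nlinarith

/-! ### G8.3 Demodulation with `cosh` helpers -/

/-- `F` of a symmetric class vector: `m_j (e^{−(ρ_j−½)u} + e^{(ρ̄_j−½)u})`. -/
theorem F_symVec (j : truncIdx N) (u : ℝ) :
    F N (symVec j) u =
      ((fib j).card : ℂ) * (cexp (-(((j : ZeroIdx).val - 1 / 2) * u)) + cexp (conj ((j : ZeroIdx).val - 1 / 2) * u)) := by
  rw [symVec, F_add', F_indVec, F_indVec, card_fib_tbar, I_mul_gamma ((j : truncIdx N) : ZeroIdx), I_mul_gamma_tbar j,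
    neg_mul, neg_neg, mul_add]

/-- `F` of the off-line helper vector, DEMODULATED at the target ordinate `τ₀`:
`e^{−iτ₀u} · Σ_j A_j (e^{−κ_j u} + e^{κ_j u}) e^{−i(τ_j−τ₀)u}`. -/
theorem F_offHelperVec {ι' : Type*} (S' : Finset ι') (g : ι' → truncIdx N) (A : ι' → ℂ) (τ₀ u : ℝ) :
    F N (offHelperVec S' g A) u =
      cexp (-(I * (τ₀ : ℂ) * u)) *
        ∑ j ∈ S', A j * (cexp (-((kap (g j) : ℂ) * u)) + cexp ((kap (g j) : ℂ) * u)) *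
          cexp (-(I * ((tau (g j) - τ₀ : ℝ) : ℂ) * u)) := by
  rw [offHelperVec, F_finset_sum, Finset.mul_sum]
  refine Finset.sum_congr rfl fun j _ ↦ ?_
  have h : ((fib (g j)).card : ℂ) ≠ 0 := Nat.cast_ne_zero.2 (fib_card_pos (g j)).ne'
  have e1 : cexp (-((((g j : truncIdx N) : ZeroIdx).val - 1 / 2) * u)) =
      cexp (-(I * (τ₀ : ℂ) * u)) * (cexp (-((kap (g j) : ℂ) * u)) * cexp (-(I * ((tau (g j) - τ₀ : ℝ) : ℂ) * u))) := by
    rw [← Complex.exp_add, ← Complex.exp_add, val_sub_half]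
    congr 1
    push_cast
    ring
  have e2 : cexp (conj (((g j : truncIdx N) : ZeroIdx).val - 1 / 2) * u) =
      cexp (-(I * (τ₀ : ℂ) * u)) * (cexp ((kap (g j) : ℂ) * u) * cexp (-(I * ((tau (g j) - τ₀ : ℝ) : ℂ) * u))) := by
    rw [← Complex.exp_add, ← Complex.exp_add, val_sub_half]
    congr 1
    simp only [map_add, map_mul, Complex.conj_ofReal, Complex.conj_I]
    push_cast
    ring
  rw [F_symVec, ← mul_assoc, div_mul_cancel₀ (A j) h, e1, e2]
  ring

/-- **Demodulated norm of the all-classes synthesis vector:**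
`‖F(allVec)(u)‖ = ‖2m₀ sinh(κ₀u) − Σ_i a_i e^{−i(t_i−τ₀)u} − Σ_j A_j (e^{−κ_j u} + e^{κ_j u}) e^{−i(τ_j−τ₀)u}‖`
(`e^{−κu} + e^{κu} = 2cosh(κu)`: the off-line helpers are `cosh`-MODULATED exponentials). [new] -/
theorem norm_F_allVec {j₀ : truncIdx N} {ι ι' : Type*} (S : Finset ι) {f : ι → truncIdx N}
    (hon : ∀ i ∈ S, ¬ ((f i : truncIdx N) : ZeroIdx).OffLine) (a : ι → ℂ)
    (S' : Finset ι') (g : ι' → truncIdx N) (A : ι' → ℂ) (u : ℝ) :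
    ‖F N (allVec j₀ S f a S' g A) u‖ =
      ‖2 * ((fib j₀).card : ℂ) * (Real.sinh (kap j₀ * u) : ℂ) -
          ∑ i ∈ S, a i * cexp (-(I * ((tau (f i) - tau j₀ : ℝ) : ℂ) * u)) -
          ∑ j ∈ S', A j * (cexp (-((kap (g j) : ℂ) * u)) + cexp ((kap (g j) : ℂ) * u)) *
            cexp (-(I * ((tau (g j) - tau j₀ : ℝ) : ℂ) * u))‖ := by
  rw [allVec, F_add', F_synthVec S hon a u, F_offHelperVec S' g A (tau j₀) u, ← mul_add, norm_mul]
  have h1 : ‖cexp (-(I * (tau j₀ : ℂ) * u))‖ = 1 := by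
    rw [show -(I * (tau j₀ : ℂ) * u) = ((-(tau j₀ * u) : ℝ) : ℂ) * I by push_cast; ring, Complex.norm_exp_ofReal_mul_I]
  rw [h1, one_mul, ← norm_neg]
  congr 1
  rw [Complex.ofReal_sinh, Complex.sinh]
  push_cast
  ring

/-- `e^{−κu} + e^{κu} = 2 cosh(κu)` (the off-line helper multiplier, for the record). -/
theorem exp_neg_add_exp_eq_two_cosh (κ u : ℝ) :
    cexp (-((κ : ℂ) * u)) + cexp ((κ : ℂ) * u) = 2 * (Real.cosh (κ * u) : ℂ) := by
  rw [Complex.ofReal_cosh, Complex.cosh]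
  push_cast
  ring

end Summit.RiemannHypothesis.RiemannHypothesis.Theorems.Splittings.BombieriTruncMassAware
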